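import Summits.CriticalPhenomena.PercolationContinuityZ3.Theorems.PercNearOneGluingNoHeavyLowerTailSunflowerRestrictionExchange
import Summits.CriticalPhenomena.PercolationContinuityZ3.Theorems.PercNearOneGluingNoHeavyLowerTailSunflowerRestrictionNoLiftedRainbow
import Summits.CriticalPhenomena.PercolationContinuityZ3.Theorems.PercNearOneGluingNoHeavyLowerTailSunflowerCloneOps
import HarnessLib

/-!
# `NoHeavyLowerTail` (crux stmt-CriticalPhenomena-4575), abstract sunflower cubic: the GOOD-COORDINATE induction principle for the
# partition lemma, and its instantiation by the three proved (MZ) mechanisms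

Support file (seat `prim-l12-p2` gen 8; `--supports stmt-CriticalPhenomena-4575`; companion of `…SunflowerRestrictionSingleton` (p222183),
`…RestrictionNoLiftedRainbow` (p226120), `…RestrictionExchange` (p226314), `…SunflowerCloneOps` (p217462)).  Memo:
run/shared/lean/prim/prim-l12/prim-l12-p2/FINDING-g8-MZ-PETAL-FREE.md §3.  Nothing is asserted about the crux; no `sorry`.

THE PRINCIPLE (`partitionLemmaH_of_goodCoordinates`).  `PartitionLemmaH` (★) follows if every sunflower `F` on every finite type has, for every
non-empty sub-cube `W`, a coordinate `e ∈ W` with EITHER restriction monotonicity at `e`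
(`F.ZP (W.erase e) ∅ ∅ ∅ ≤ F.ZP W ∅ ∅ ∅`) OR the concave-pencil inequality `2·F.ZP (W.erase e) ∅ ∅ ∅ + (F.con e).ZP (W.erase e) ∅ ∅ ∅ ≤ F.ZP W ∅ ∅ ∅`
(`F.con e` = the upper section, `…SunflowerCloneOps`): strong induction on `|W|`, the second branch using the induction hypothesis for `F` AND for `F.con e`.
(`partitionLemmaH_of_restrictionMonotonicity` of prove-1 is the special case "first branch, every e".)

THE THREE MECHANISMS (`goodCoordinate_of_criteria`): the disjunction holds at `e` whenever (A) `F.lab {e} ≠ 0` (p222183), or (NLR) `e` creates no lifted rainbow on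
`2^(W.erase e)` (p226120), or (H*) no ordered 3-partition of `W.erase e` has two blocks with same-direction petal transitions under `e` (p226314).  CENSUS (memo §3):
some such `e` exists for EVERY sunflower on ≤ 5 points (all 2 189 536 kernel-canonical maps at 5 points), for 99.97 % of random 6-point and ≈ 99.9 % / 99.7 % of random 7/8-point
sunflowers; the first map with no good coordinate is the doubled co-star on 6 points.  So ★ for |α| ≤ 5 is a corollary of the three theorems plus a finite search for good
orders (not replayed here), and the open core of ★ is the set of sunflowers none of whose coordinates satisfies (A) ∨ (NLR) ∨ (H*).
-/

namespace Summit.CriticalPhenomena.PercolationContinuityZ3.Theorems.SunflowerPartition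

open Finset

variable {α : Type*} [Fintype α] [DecidableEq α]

namespace Sunflower

variable (F : Sunflower α)

/-- The partition functional of the upper section: `(F.con e).ZP W ∅ ∅ ∅ = F.ZP W {e} {e} {e}`. [this work] -/
theorem con_ZP_eq (W : Finset α) (e : α) : (F.con e).ZP W ∅ ∅ ∅ = F.ZP W {e} {e} {e} := by
  unfold Sunflower.ZP
  refine sum_congr rfl fun q _ => ?_
  rw [F.lab_con, F.lab_con, F.lab_con, empty_union, empty_union, empty_union, ← insert_eq, ← insert_eq, ← insert_eq]

end Sunflower

/-- **The good-coordinate induction principle** (this work): if every sunflower has, on every non-empty sub-cube `W`, a coordinate `e ∈ W` at which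
either restriction monotonicity or the concave-pencil inequality holds, then the partition lemma ★ holds. -/
theorem partitionLemmaH_of_goodCoordinates
    (hgood : ∀ (β : Type) [Fintype β] [DecidableEq β] (F : Sunflower β) (W : Finset β), W.Nonempty →
      ∃ e ∈ W, F.ZP (W.erase e) ∅ ∅ ∅ ≤ F.ZP W ∅ ∅ ∅ ∨
        2 * F.ZP (W.erase e) ∅ ∅ ∅ + (F.con e).ZP (W.erase e) ∅ ∅ ∅ ≤ F.ZP W ∅ ∅ ∅) :
    PartitionLemmaH := by
  have key : ∀ (n : ℕ) (β : Type) [Fintype β] [DecidableEq β] (F : Sunflower β) (W : Finset β), W.card = n → 0 ≤ F.ZP W ∅ ∅ ∅ := by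
    intro n
    induction n using Nat.strong_induction_on with
    | _ n ih =>
      intro β _ _ F W hW
      rcases W.eq_empty_or_nonempty with hE | hne
      · subst hE; rw [F.ZP_empty]
      · obtain ⟨e, he, h⟩ := hgood β F W hne
        have hcard : (W.erase e).card = n - 1 := by rw [card_erase_of_mem he, hW]
        have hlt : n - 1 < n := by
          have : 0 < n := by rw [← hW]; exact card_pos.2 hne
          omega
        have ih1 := ih (n - 1) hlt β F (W.erase e) hcard
        rcases h with h1 | h2
        · exact le_trans ih1 h1
        · have ih2 := ih (n - 1) hlt β (F.con e) (W.erase e) hcard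
          linarith
  intro β _ _ F
  rw [← F.ZP_univ_empty]
  exact key _ β F univ rfl

/-- **The three mechanisms discharge the good-coordinate disjunction** (this work): at `e ∈ W`, each of (A) `lab {e} ≠ 0`, (NLR) no lifted rainbow on
`2^(W.erase e)`, (H*) no two blocks with same-direction petal transitions, gives one of the two branches. -/
theorem Sunflower.goodCoordinate_of_criteria (F : Sunflower α) (W : Finset α) (e : α) (he : e ∈ W)
    (h : F.lab {e} ≠ 0 ∨
      (∀ X ∈ (W.erase e).powerset, ∀ S ∈ ((W.erase e) \ X).powerset,
          triP (F.lab (insert e X)) (F.lab S) (F.lab (((W.erase e) \ X) \ S)) = 0) ∨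
      (∀ X ∈ (W.erase e).powerset, ∀ S ∈ ((W.erase e) \ X).powerset,
        ¬ (((F.lab X ≠ 0 ∧ F.lab X ≠ 4) ∧ F.lab (insert e X) = 4 ∧ (F.lab S ≠ 0 ∧ F.lab S ≠ 4) ∧ F.lab (insert e S) = 4) ∨
           (F.lab X = 0 ∧ (F.lab (insert e X) ≠ 0 ∧ F.lab (insert e X) ≠ 4) ∧ F.lab S = 0 ∧ (F.lab (insert e S) ≠ 0 ∧ F.lab (insert e S) ≠ 4))))) :
    F.ZP (W.erase e) ∅ ∅ ∅ ≤ F.ZP W ∅ ∅ ∅ ∨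
      2 * F.ZP (W.erase e) ∅ ∅ ∅ + (F.con e).ZP (W.erase e) ∅ ∅ ∅ ≤ F.ZP W ∅ ∅ ∅ := by
  have hne : e ∉ W.erase e := notMem_erase e W
  rcases h with hA | hN | hX
  · left
    have := F.ZP_le_ZP_insert_of_lab_singleton_ne_zero (W.erase e) e hne hA
    rwa [insert_erase he] at this
  · left
    have := F.ZP_le_ZP_insert_of_no_lifted_rainbow (W.erase e) e hne hN
    rwa [insert_erase he] at this
  · right
    have := F.ZP_insert_ge_of_no_sameDir (W.erase e) e hne hX
    rwa [insert_erase he, ← F.con_ZP_eq] at this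

end Summit.CriticalPhenomena.PercolationContinuityZ3.Theorems.SunflowerPartition
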